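import Summits.PneNP.PneNP.Theorems.SfmBlMachineHat
import Summits.PneNP.PneNP.Theorems.SfmBlMachineTrace

/-!
# Line «sfm-bl», MACHINE LAYER M5-GREEDY: parameters, static data and the greedy signing loop (stmt-PneNP-20523)

FRONTIER F-N1c; nothing here bears on P vs NP.

MACHINE-PLAN (pnp-ideate-p3 g14) stage **M5**, the SPEC of the whole machine as plain (list) functions of the decoded
instance `(m, trips)`:
* constants `L0 = 2^60` (block length), `γsq0 = 3600·(6000·2^60)` (`γ_sp²`), `G0 = 6000·2^60` (`γ'²`);
* parameters of `N = #pieces` (`SfmBlParamsFP`): `prmB N = size N` (`b`), `prmJ1 N = size (size (20N))` (`j + 1`),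
  `prmT0 N = (2·2^(j+1) + 2b)/10` (`t₀`), clamped copies `prmT0' = min t₀ (40N)`, `prmQ1' = min 2^(j+1) (40N)`
  (`= q + 1`; the clamps are inactive for `N ≥ 1` by `SfmBl.sfmBl_params_bounds` and make the unary conversions
  of the typing exact on every input);
* static data: `sfmPlegs` (M1), `sfmN`, the caps `sfmCapW = (40N)^121` (walks), `sfmCapA = 3m·(40N)^240`
  (alternating sequences), `sfmCapS = 40N` (sublists) — all `≥` the true counts by `sfmBl_params_bounds`, so the
  capped enumerations are the uncapped ones —, `sfmCands` (M2a), `sfmExtract` (M2b, `3m + 1` rounds), `sfmR'`,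
  `sfmRlegs` (M3a), `sfmRecs` (M4), `sfmV = Σ_s (|V₁ s| + |V₂ s|)`, the integer weights `sfmC₁ = p₂·q₁`,
  `sfmC₂ = p₁·q₂` of the ONE integer comparison (`SfmBl.frac_compare_int_iff`, fractions `sfmBl_A₁_frac'`,
  `sfmBl_A₃_frac`);
* the loop: `potVal m trips kk T0 = C₁·traceSum kk T0 2^(m−kk+1) … + C₂·hatSum G0 kk T0 m …` (the scaled `F`-sum over the
  cylinder of the prefix `T0` of length `kk`), `greedyStep` (append the bit with the smaller potential, `false` on
  ties), `greedyBits m trips`, and the string function `sfmStr` (decoder of `CandFewHeadsRungFPDecode` in front).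
Proved here: `length_greedyBits`, `greedyBits_prefix` (the loop's invariant: step `k` extends the first `k` bits),
`potVal_greedy_le` (the chosen bit has the smaller potential), `sfmStr_encode`.
Typing (`CodeFP`) is `SfmBlMachineGreedyFP`; the semantics of `potVal` is the closer's business.
-/

set_option linter.dupNamespace false -- `Summit.PneNP.PneNP.…`: summit = sub-problem name (D-0017 single-conjunct layout)

namespace Summit.PneNP.PneNP.Theorems.SfmBlMachine

open Literature.Computability.Complexity
open Summit.PneNP.PneNP.Theorems.Nc03AvoidResidualCoreCandFewHeadsRungFP

/-! ## Constants and parameters -/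

/-- Block length `L = 2^60`. -/
def L0 : ℕ := 2 ^ 60

/-- `γ_sp² = 3600 · (6000 · 2^60)` (the extraction's integer density threshold). -/
def γsq0 : ℕ := 3600 * (6000 * 2 ^ 60)

/-- `γ'² = 6000 · 2^60` (the bad-pair threshold). -/
def G0 : ℕ := 6000 * 2 ^ 60

/-- `b = size N`. -/
def prmB (N : ℕ) : ℕ := Nat.size N

/-- `j + 1 = size (size (20N))`. -/
def prmJ1 (N : ℕ) : ℕ := Nat.size (Nat.size (20 * N))

/-- `t₀ = (2·2^(j+1) + 2b) / 10`. -/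
def prmT0 (N : ℕ) : ℕ := (2 * 2 ^ prmJ1 N + 2 * prmB N) / 10

/-- `t₀` clamped by `40N` (inactive for `N ≥ 1`). -/
def prmT0' (N : ℕ) : ℕ := min (prmT0 N) (40 * N)

/-- `q + 1 = 2^(j+1)` clamped by `40N` (inactive for `N ≥ 1`). -/
def prmQ1' (N : ℕ) : ℕ := min (2 ^ prmJ1 N) (40 * N)

/-! ## Static data of the instance -/

/-- The pieced legs (M1). -/
def sfmPlegs (trips : List (ℕ × ℕ × ℕ)) : List PLeg := pieceLegs L0 trips

/-- `N = #pieces`. -/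
def sfmN (trips : List (ℕ × ℕ × ℕ)) : ℕ := (pieces (sfmPlegs trips)).length

/-- The walk cap `(40N)^121`. -/
def sfmCapW (trips : List (ℕ × ℕ × ℕ)) : ℕ := (40 * sfmN trips) ^ 121

/-- The alternating-sequence cap `3m · (40N)^240`. -/
def sfmCapA (trips : List (ℕ × ℕ × ℕ)) : ℕ := 3 * trips.length * (40 * sfmN trips) ^ 240

/-- The sublist cap `40N`. -/
def sfmCapS (trips : List (ℕ × ℕ × ℕ)) : ℕ := 40 * sfmN trips

/-- The candidate pairs (M2a + sides), walks of length `2(t₀ − 1)`. -/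
def sfmCands (trips : List (ℕ × ℕ × ℕ)) : List Cand :=
  cands (sfmPlegs trips) (sfmCapW trips) (prmT0' (sfmN trips)) (List.replicate (2 * (prmT0' (sfmN trips) - 1)) ())

/-- The extraction output `(labels, r)` (M2b), `3m + 1` rounds. -/
def sfmExtract (trips : List (ℕ × ℕ × ℕ)) : List ℕ × ℕ :=
  extract γsq0 (sfmPlegs trips) (sfmCands trips) (List.replicate ((sfmPlegs trips).length + 1) ())

/-- The number of spots, clamped by the number of rounds (inactive, `ExtractInv`). -/
def sfmR' (trips : List (ℕ × ℕ × ℕ)) : ℕ := min (sfmExtract trips).2 ((sfmPlegs trips).length + 1)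

/-- The remainder legs (M3a). -/
def sfmRlegs (trips : List (ℕ × ℕ × ℕ)) : List PLeg := rlegs (sfmPlegs trips) (sfmExtract trips).1

/-- The rounds of the alternating-sequence enumeration: `2(q+1) − 1`. -/
def sfmUA (trips : List (ℕ × ℕ × ℕ)) : List Unit := List.replicate (2 * prmQ1' (sfmN trips) - 1) ()

/-- The pair records of all spots (M4). -/
def sfmRecs (trips : List (ℕ × ℕ × ℕ)) : List PRec :=
  allRecs (sfmCapS trips) (sfmCapW trips) (sfmPlegs trips) (sfmExtract trips).1 (sfmR' trips)

/-- `V = Σ_s (|V₁ s| + |V₂ s|)` (sides of the spots). -/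
def sfmV (trips : List (ℕ × ℕ × ℕ)) : ℕ :=
  ((List.range (sfmR' trips)).map fun s =>
    (lpieces (slegs (sfmPlegs trips) (sfmExtract trips).1 s)).length
      + (rpieces (slegs (sfmPlegs trips) (sfmExtract trips).1 s)).length).sum

/-- The exponent `ℓ = 2(q+1) = 2^(j+2)` of the trace. -/
def sfmEll (trips : List (ℕ × ℕ × ℕ)) : ℕ := 2 * prmQ1' (sfmN trips)

/-- `C₁ = p₂ · q₁ = 6(4V + (2^60)^10) · 20^ℓ` (weight of the trace part). -/
def sfmC₁ (trips : List (ℕ × ℕ × ℕ)) : ℕ := 6 * (4 * sfmV trips + (2 ^ 60) ^ 10) * 20 ^ sfmEll trips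

/-- `C₂ = p₁ · q₂ = 10(N·2^(60ℓ) + 20^ℓ) · (5·(2^60)^10)` (weight of the hat part). -/
def sfmC₂ (trips : List (ℕ × ℕ × ℕ)) : ℕ :=
  10 * (sfmN trips * 2 ^ (60 * sfmEll trips) + 20 ^ sfmEll trips) * (5 * (2 ^ 60) ^ 10)

/-! ## The greedy loop -/

/-- THE SCALED POTENTIAL of the cylinder of the prefix `T0` (length `kk`):
`C₁ · Σ_cyl tr + C₂ · Σ_cyl Σ_s ê_s` with `pw = 2^(m − kk + 1) = 2^{#free + 1}`. -/
def potVal (m : ℕ) (trips : List (ℕ × ℕ × ℕ)) (kk : ℕ) (T0 : List Bool) : ℤ :=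
  (sfmC₁ trips : ℤ) * traceSum kk T0 (2 ^ (m - kk + 1)) (sfmRlegs trips) (sfmCapA trips) (sfmUA trips)
    + (sfmC₂ trips : ℤ) * (hatSum G0 kk T0 m (sfmRecs trips) : ℤ)

/-- One greedy step: append the bit whose cylinder has the smaller potential (`false` on ties). -/
def greedyStep (m : ℕ) (trips : List (ℕ × ℕ × ℕ)) (acc : List Bool) : List Bool :=
  if potVal m trips (acc.length + 1) (acc ++ [false]) ≤ potVal m trips (acc.length + 1) (acc ++ [true])
  then acc ++ [false] else acc ++ [true]

/-- The greedy signing after `|u|` steps. -/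
def greedyRun (m : ℕ) (trips : List (ℕ × ℕ × ℕ)) (u : List Unit) : List Bool :=
  u.foldl (fun acc _ => greedyStep m trips acc) []

/-- **The greedy signing**: `m` steps. -/
def greedyBits (m : ℕ) (trips : List (ℕ × ℕ × ℕ)) : List Bool := greedyRun m trips (List.replicate m ())

/-- **THE MACHINE**: decode the tokens of a pure-`CAND` code, run the greedy signing. -/
def sfmStr (w : List Bool) : List Bool := greedyBits ((runs w).getD 1 0) (tripsTok (runs w))

/-! ## The loop's invariant -/

/-- One step appends one bit. -/
theorem greedyStep_eq_append (m : ℕ) (trips : List (ℕ × ℕ × ℕ)) (acc : List Bool) :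
    ∃ b, greedyStep m trips acc = acc ++ [b] := by
  unfold greedyStep
  split_ifs
  · exact ⟨false, rfl⟩
  · exact ⟨true, rfl⟩

/-- The run has one bit per step. -/
theorem length_greedyRun (m : ℕ) (trips : List (ℕ × ℕ × ℕ)) (u : List Unit) : (greedyRun m trips u).length = u.length := by
  unfold greedyRun
  suffices h : ∀ (u : List Unit) (acc : List Bool),
      (u.foldl (fun acc _ => greedyStep m trips acc) acc).length = acc.length + u.length by
    simpa using h u []
  intro u
  induction u with
  | nil => intro acc; simp
  | cons _ u ih =>
    intro acc
    rw [List.foldl_cons, ih]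
    obtain ⟨b, hb⟩ := greedyStep_eq_append m trips acc
    rw [hb, List.length_append, List.length_singleton, List.length_cons]; omega

/-- **The greedy signing has `m` bits.** -/
theorem length_greedyBits (m : ℕ) (trips : List (ℕ × ℕ × ℕ)) : (greedyBits m trips).length = m := by
  unfold greedyBits; rw [length_greedyRun, List.length_replicate]

/-- More steps extend the run. -/
theorem greedyRun_append (m : ℕ) (trips : List (ℕ × ℕ × ℕ)) (u v : List Unit) :
    greedyRun m trips (u ++ v) = v.foldl (fun acc _ => greedyStep m trips acc) (greedyRun m trips u) := by
  unfold greedyRun; rw [List.foldl_append]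

/-- A run is a prefix of any longer run. -/
theorem greedyRun_prefix (m : ℕ) (trips : List (ℕ × ℕ × ℕ)) :
    ∀ (v u : List Unit), (greedyRun m trips (u ++ v)).take u.length = greedyRun m trips u := by
  intro v
  induction v with
  | nil => intro u; rw [List.append_nil, ← length_greedyRun m trips u, List.take_length]
  | cons x v ih =>
    intro u
    have h := ih (u ++ [x])
    rw [List.append_assoc, List.singleton_append, List.length_append, List.length_singleton] at h
    have h2 : (greedyRun m trips (u ++ x :: v)).take u.length
        = ((greedyRun m trips (u ++ x :: v)).take (u.length + 1)).take u.length := by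
      rw [List.take_take, min_eq_left (Nat.le_succ _)]
    rw [h2, h, greedyRun_append]
    simp only [List.foldl_cons, List.foldl_nil]
    obtain ⟨b, hb⟩ := greedyStep_eq_append m trips (greedyRun m trips u)
    rw [hb, List.take_append_of_le_length (by rw [length_greedyRun]), ← length_greedyRun m trips u, List.take_length]

/-- **THE INVARIANT**: for `k < m`, the first `k + 1` bits of the greedy signing are the greedy step applied to its
first `k` bits. -/
theorem greedyBits_prefix (m : ℕ) (trips : List (ℕ × ℕ × ℕ)) {k : ℕ} (hk : k < m) :
    (greedyBits m trips).take (k + 1) = greedyStep m trips ((greedyBits m trips).take k) := by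
  unfold greedyBits
  have hsplit : ∀ i, i ≤ m → List.replicate m () = List.replicate i () ++ List.replicate (m - i) () := fun i hi => by
    rw [← List.replicate_add]; congr 1; omega
  have h1 : (greedyRun m trips (List.replicate m ())).take (k + 1) = greedyRun m trips (List.replicate (k + 1) ()) := by
    have := greedyRun_prefix m trips (List.replicate (m - (k + 1)) ()) (List.replicate (k + 1) ())
    rw [List.length_replicate, ← hsplit (k + 1) hk] at this
    exact this
  have h2 : (greedyRun m trips (List.replicate m ())).take k = greedyRun m trips (List.replicate k ()) := by
    have := greedyRun_prefix m trips (List.replicate (m - k) ()) (List.replicate k ())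
    rw [List.length_replicate, ← hsplit k hk.le] at this
    exact this
  rw [h1, h2, List.replicate_succ', greedyRun_append]
  simp

/-- **THE GREEDY CHOICE**: at every step the chosen bit's cylinder has potential at most the sibling's. -/
theorem potVal_greedyStep_le (m : ℕ) (trips : List (ℕ × ℕ × ℕ)) (acc : List Bool) :
    ∃ b, greedyStep m trips acc = acc ++ [b] ∧
      potVal m trips (acc.length + 1) (acc ++ [b]) ≤ potVal m trips (acc.length + 1) (acc ++ [!b]) := by
  unfold greedyStep
  split_ifs with h
  · exact ⟨false, rfl, h⟩
  · exact ⟨true, rfl, (not_le.1 h).le⟩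

/-! ## On the code of an instance -/

variable {n m : ℕ}

/-- **On the code of a pure-`CAND` instance the machine runs the greedy signing on its triples.** -/
theorem sfmStr_encode {I : LocalMap 3 n m} (hI : I.IsPure candPred) : sfmStr I.encode = greedyBits m (trips I) := by
  rw [sfmStr, runs_encode hI, toks_getD_one, tripsTok_toks]

end Summit.PneNP.PneNP.Theorems.SfmBlMachine
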